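import Literature.Geometry.Lorentzian.KissingBallsCutMass
import Literature.Geometry.Lorentzian.KasnerTrappedSphere
import HarnessLib

/-!
# The round sections `y ↦ (r, r y)` of the light cone of Minkowski spacetime:
# smooth spacelike spheres with the null normal pair `((1, y), (1, -y))`

Stub `stub_minkowskiSphereSection` (S2) of the sanity tier of crux `HorizonlessMustDrain`
(route `BondiDrainDispersal`, summit `FinalStateConjecture`): in the Minkowski development
`Literature.Geometry.Lorentzian.Minkowski.vacuumCauchyDevelopment` (carrier `E4`, metric `η`,
time orientation `∂ₜ`) the map `y ↦ (r, r y)` of the unit sphere `S² ⊂ E3`, `r > 0`, is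

* a smooth embedding (`Manifold.IsSmoothEmbedding`): it is `C^∞` (an affine map of `E3`
  restricted to the sphere, Mathlib's `contMDiff_coe_sphere`), injective, with injective
  differential `v ↦ (0, r dι v)` (`mfderiv_coe_sphere_injective`), on the compact sphere — the
  tree's immersion criterion
  `Literature.Topology.FourManifolds.isSmoothEmbedding_of_injective_of_injective_mfderiv`;
* a spacelike immersion for `η`: `η((0, r dι v), (0, r dι v)) = r² ‖dι v‖² > 0` for `v ≠ 0`;
* and carries the null normal pair `L = (1, y)`, `L̲ = (1, -y)`: both are `η`-normal to the
  sphere (`⟪y, dι v⟫ = 0`, Mathlib's `range_mfderiv_coe_sphere`), null (`-1 + ‖y‖² = 0`),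
  future-directed for `∂ₜ` (`η(∂ₜ, (1, ±y)) = -1 < 0`), normalised `η(L, L̲) = -1 - ‖y‖² = -2`,
  and smooth along the sphere (sections of the trivial tangent bundle of the model space `E4`).

The template is `Literature/Geometry/Lorentzian/KasnerTrappedSphere.lean` (round spheres in a
constant diagonal metric on a chart domain); here the target is the model space `E4` itself and
the metric is the constant form `Minkowski.bilin`, so everything is shorter.  The carrier, model,
metric and time orientation of `Minkowski.vacuumCauchyDevelopment` are `E4`, `𝓡 (3 + 1) = 𝓘(ℝ, E4)`,
`Minkowski.smoothMetric` (`val = bilin`) and `∂ₜ = E4.basisVector 0`, each by `rfl`; the helper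
lemmas are stated over `𝓘(ℝ, E4)` and converted by `change`/`exact`.

## References

* B. O'Neill, *Semi-Riemannian Geometry with Applications to Relativity*, Academic Press 1983,
  Ch. 4, p. 97 ff. (induced metric, normal fields), Ch. 5, p. 142 (spacelike submanifolds).
  [ONeill1983]
* S. W. Hawking, G. F. R. Ellis, *The Large Scale Structure of Space-Time*, CUP 1973, §4.2
  (null normals `(L, L̲)` of a spacelike two-surface). [HawkingEllis1973]
-/

-- D-0017: single-problem summit, namespace `Summit.FinalStateConjecture.FinalStateConjecture.…` by design;
-- the Summits library sets this option in the lakefile, a standalone check does not.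
set_option linter.dupNamespace false

noncomputable section

open Set Function Metric Bundle
open scoped Manifold ContDiff Topology RealInnerProductSpace

namespace Summit.FinalStateConjecture.FinalStateConjecture.Theorems.BondiDrainDispersalHorizonlessMustDrain

namespace MinkowskiSphereSection

open Literature.Geometry.Lorentzian Literature.Geometry.Lorentzian.Minkowski
  Literature.Geometry.Lorentzian.Kasner

/-! ### The affine maps `y ↦ (t, y)` of `E3` into `E4` -/

/-- The slice map `y ↦ (0, y)` is a continuous linear map `E3 →L[ℝ] E4`
(`Minkowski.isLinearMap_ofTimeSpace_zero`). [folklore] -/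
theorem exists_clm_ofTimeSpace_zero :
    ∃ L : E3 →L[ℝ] E4, (L : E3 → E4) = E4.ofTimeSpace 0 :=
  ⟨LinearMap.toContinuousLinearMap (IsLinearMap.mk' _ isLinearMap_ofTimeSpace_zero), rfl⟩

/-- `η((s, v), (t, w)) = -s t + ⟪v, w⟫` (O'Neill 1983, Ch. 3, p. 55). [cite: ONeill1983, Ch. 3, p. 55] -/
theorem bilin_ofTimeSpace (s t : ℝ) (v w : E3) :
    bilin (E4.ofTimeSpace s v) (E4.ofTimeSpace t w) = -(s * t) + ⟪v, w⟫ := by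
  rw [bilin_apply]
  simp only [E4.ofTimeSpace_apply_zero, E4.ofTimeSpace_apply_succ, PiLp.inner_apply,
    RCLike.inner_apply, conj_trivial]
  congr 1
  exact Finset.sum_congr rfl fun i _ ↦ mul_comm _ _

/-- The slice maps `y ↦ (t, y)` are `C^m` for every `m` (affine: `(t, y) = t ∂ₜ + (0, y)`,
`E4.ofTimeSpace_eq_smul_add`). [folklore] -/
theorem contDiff_ofTimeSpace (t : ℝ) {m : ℕ∞ω} : ContDiff ℝ m (E4.ofTimeSpace t) := by
  obtain ⟨L, hL⟩ := exists_clm_ofTimeSpace_zero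
  have h : E4.ofTimeSpace t = fun x ↦ t • E4.basisVector 0 + L x := by
    funext x
    rw [E4.ofTimeSpace_eq_smul_add, ← hL]
  rw [h]
  exact contDiff_const.add L.contDiff

/-- The ambient section map `x ↦ (r, r x)` of `E3` is `C^m` for every `m`. [folklore] -/
theorem contDiff_secAmbient (r : ℝ) {m : ℕ∞ω} :
    ContDiff ℝ m (fun x : E3 ↦ E4.ofTimeSpace r (r • x)) :=
  (contDiff_ofTimeSpace r).comp (contDiff_const_smul r)

/-- The ambient section map `x ↦ (r, r x)` has Fréchet derivative `v ↦ (0, r v)` everywhere.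
[folklore] -/
theorem hasFDerivAt_secAmbient (r : ℝ) (x : E3) {L : E3 →L[ℝ] E4}
    (hL : (L : E3 → E4) = E4.ofTimeSpace 0) :
    HasFDerivAt (fun z : E3 ↦ E4.ofTimeSpace r (r • z)) (r • L) x := by
  have h : (fun z : E3 ↦ E4.ofTimeSpace r (r • z)) =
      fun z ↦ r • E4.basisVector 0 + r • L z := by
    funext z
    rw [E4.ofTimeSpace_eq_smul_add, ← hL, L.map_smul]
  rw [h]
  exact ((L.hasFDerivAt).const_smul r).const_add _

/-! ### The section `y ↦ (r, r y)` of the unit sphere: smoothness, differential, embedding -/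

/-- **The section `y ↦ (r, r y)` is a smooth map `S² → E4`** (an affine map of `E3` restricted
to the sphere; Mathlib's `contMDiff_coe_sphere`). [cite: ONeill1983, Ch. 4, p. 97] -/
theorem contMDiff_sec (r : ℝ) {m : ℕ∞ω} :
    ContMDiff (𝓡 2) 𝓘(ℝ, E4) m
      (fun y : sphere (0 : E3) 1 ↦ E4.ofTimeSpace r (r • (y : E3))) := by
  haveI := factFinrankE3
  exact (contDiff_secAmbient r).contMDiff.comp (contMDiff_coe_sphere (n := 2))

/-- **The differential of the section**: `d(y ↦ (r, r y))_y v = (0, r dι_y v)` (chain rule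
through the inclusion `ι : S² ⊂ E3`, `Kasner.dS`). [cite: ONeill1983, Ch. 4, p. 97] -/
theorem mfderiv_sec (r : ℝ) (y : sphere (0 : E3) 1) (v : TangentSpace (𝓡 2) y) :
    mfderiv (𝓡 2) 𝓘(ℝ, E4) (fun y : sphere (0 : E3) 1 ↦ E4.ofTimeSpace r (r • (y : E3))) y v =
      E4.ofTimeSpace 0 (r • dS y v) := by
  obtain ⟨L, hL⟩ := exists_clm_ofTimeSpace_zero
  have h : HasMFDerivAt (𝓡 2) 𝓘(ℝ, E4)
      ((fun z : E3 ↦ E4.ofTimeSpace r (r • z)) ∘ (Subtype.val : sphere (0 : E3) 1 → E3)) y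
      ((r • L).comp (mfderiv (𝓡 2) 𝓘(ℝ, E3) (Subtype.val : sphere (0 : E3) 1 → E3) y)) :=
    (hasFDerivAt_secAmbient r (y : E3) hL).hasMFDerivAt.comp y
      (mdifferentiableAt_coe_sphere y).hasMFDerivAt
  have hfun : (fun y : sphere (0 : E3) 1 ↦ E4.ofTimeSpace r (r • (y : E3))) =
      (fun z : E3 ↦ E4.ofTimeSpace r (r • z)) ∘ (Subtype.val : sphere (0 : E3) 1 → E3) := rfl
  rw [hfun, h.mfderiv]
  change r • L (dS y v) = E4.ofTimeSpace 0 (r • dS y v)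
  rw [← hL, L.map_smul]

/-- The section `y ↦ (r, r y)` is injective for `r ≠ 0`. [folklore] -/
theorem sec_injective {r : ℝ} (hr : r ≠ 0) :
    Injective (fun y : sphere (0 : E3) 1 ↦ E4.ofTimeSpace r (r • (y : E3))) :=
  fun _ _ h ↦ Subtype.ext (smul_right_injective E3 hr (E4.ofTimeSpace_injective r h))

/-- The differential of the section `y ↦ (r, r y)` is injective for `r ≠ 0` (Mathlib's
`mfderiv_coe_sphere_injective`). [folklore] -/
theorem mfderiv_sec_injective {r : ℝ} (hr : r ≠ 0) (y : sphere (0 : E3) 1) :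
    Injective (mfderiv (𝓡 2) 𝓘(ℝ, E4)
      (fun y : sphere (0 : E3) 1 ↦ E4.ofTimeSpace r (r • (y : E3))) y) := by
  haveI := factFinrankE3
  intro v w h
  rw [mfderiv_sec, mfderiv_sec] at h
  have h2 : dS y v = dS y w := smul_right_injective E3 hr (E4.ofTimeSpace_injective 0 h)
  exact mfderiv_coe_sphere_injective (n := 2) y h2

/-- **The section `y ↦ (r, r y)`, `r ≠ 0`, is a smooth embedding of `S²` into `E4`**
(`Manifold.IsSmoothEmbedding`; an injective immersion of the compact sphere into the Hausdorff
space `E4`, by the tree's immersion criterion). [cite: ONeill1983, Ch. 4, p. 97] -/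
theorem isSmoothEmbedding_sec {r : ℝ} (hr : r ≠ 0) :
    Manifold.IsSmoothEmbedding (𝓡 2) 𝓘(ℝ, E4) ∞
      (fun y : sphere (0 : E3) 1 ↦ E4.ofTimeSpace r (r • (y : E3))) :=
  Literature.Topology.FourManifolds.isSmoothEmbedding_of_injective_of_injective_mfderiv
    (contMDiff_sec r) (by exact_mod_cast le_top) (sec_injective hr) (mfderiv_sec_injective hr)

/-! ### The induced metric and the null normals `(1, ±y)` -/

/-- **The induced metric of the section is `r²` times the round metric**:
`η(d sec v, d sec w) = r² ⟪dι v, dι w⟫`. [cite: ONeill1983, Ch. 4, p. 97] -/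
theorem bilin_mfderiv_sec (r : ℝ) (y : sphere (0 : E3) 1) (v w : TangentSpace (𝓡 2) y) :
    bilin (mfderiv (𝓡 2) 𝓘(ℝ, E4)
        (fun y : sphere (0 : E3) 1 ↦ E4.ofTimeSpace r (r • (y : E3))) y v)
      (mfderiv (𝓡 2) 𝓘(ℝ, E4)
        (fun y : sphere (0 : E3) 1 ↦ E4.ofTimeSpace r (r • (y : E3))) y w) =
      r ^ 2 * ⟪dS y v, dS y w⟫ := by
  rw [mfderiv_sec, mfderiv_sec, bilin_ofTimeSpace, real_inner_smul_left, real_inner_smul_right]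
  ring

/-- The induced metric of the section is positive definite for `r ≠ 0`:
`η(d sec v, d sec v) = r² ‖dι v‖² > 0` for `v ≠ 0`. [cite: ONeill1983, Ch. 5, p. 142] -/
theorem bilin_mfderiv_sec_pos {r : ℝ} (hr : r ≠ 0) (y : sphere (0 : E3) 1)
    {v : TangentSpace (𝓡 2) y} (hv : v ≠ 0) :
    0 < bilin (mfderiv (𝓡 2) 𝓘(ℝ, E4)
        (fun y : sphere (0 : E3) 1 ↦ E4.ofTimeSpace r (r • (y : E3))) y v)
      (mfderiv (𝓡 2) 𝓘(ℝ, E4)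
        (fun y : sphere (0 : E3) 1 ↦ E4.ofTimeSpace r (r • (y : E3))) y v) := by
  haveI := factFinrankE3
  rw [bilin_mfderiv_sec, real_inner_self_eq_norm_sq]
  have hne : dS y v ≠ 0 := by
    intro h
    apply hv
    refine mfderiv_coe_sphere_injective (n := 2) y ?_
    rw [map_zero]
    exact h
  have h1 : 0 < ‖dS y v‖ := norm_pos_iff.mpr hne
  have h2 : 0 < r ^ 2 := by positivity
  positivity

/-- **`(1, u)` is `η`-normal to the section at `y` whenever `⟪u, ·⟫` kills `T_y S²`** — used for
`u = ±y`: `η((1, ±y), (0, r dι v)) = ± r ⟪y, dι v⟫ = 0` (`Kasner.inner_mfderiv_coe_sphere`).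
[cite: HawkingEllis1973, §4.2] -/
theorem bilin_ofTimeSpace_one_mfderiv_sec (r : ℝ) (y : sphere (0 : E3) 1) (s : ℝ)
    (v : TangentSpace (𝓡 2) y) :
    bilin (E4.ofTimeSpace 1 (s • (y : E3)))
      (mfderiv (𝓡 2) 𝓘(ℝ, E4)
        (fun y : sphere (0 : E3) 1 ↦ E4.ofTimeSpace r (r • (y : E3))) y v) = 0 := by
  rw [mfderiv_sec, bilin_ofTimeSpace, real_inner_smul_left, real_inner_smul_right,
    inner_mfderiv_coe_sphere]
  ring

/-- `η((1, s y), (1, s' y)) = -1 + s s'` for a unit vector `y` (so `(1, ±y)` are null and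
`η((1, y), (1, -y)) = -2`). [cite: HawkingEllis1973, §4.2] -/
theorem bilin_ofTimeSpace_one_smul (y : sphere (0 : E3) 1) (s s' : ℝ) :
    bilin (E4.ofTimeSpace 1 (s • (y : E3))) (E4.ofTimeSpace 1 (s' • (y : E3))) = -1 + s * s' := by
  rw [bilin_ofTimeSpace, real_inner_smul_left, real_inner_smul_right, real_inner_self_eq_norm_sq,
    norm_eq_of_mem_sphere y]
  ring

/-- `(1, u) ≠ 0` (its time component is `1`). [folklore] -/
theorem ofTimeSpace_one_ne_zero (u : E3) : E4.ofTimeSpace 1 u ≠ 0 := fun h ↦ by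
  have := congrArg (fun x : E4 ↦ x 0) h
  simp at this

/-- `η(∂ₜ, (1, u)) = -1 < 0`: `(1, u)` lies in the future cone of `∂ₜ`. [cite: HawkingEllis1973, §4.2] -/
theorem bilin_basisVector_zero_ofTimeSpace_one (u : E3) :
    bilin (E4.basisVector 0) (E4.ofTimeSpace 1 u) = -1 := by
  rw [bilin_basisVector_zero_left, E4.ofTimeSpace_apply_zero]

/-- The fields `y ↦ (1, s y)` are `C^m` maps `S² → E4` for every `m`. [folklore] -/
theorem contMDiff_ofTimeSpace_one_smul (s : ℝ) {m : ℕ∞ω} :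
    ContMDiff (𝓡 2) 𝓘(ℝ, E4) m (fun y : sphere (0 : E3) 1 ↦ E4.ofTimeSpace 1 (s • (y : E3))) := by
  haveI := factFinrankE3
  exact ((contDiff_ofTimeSpace 1).comp (contDiff_const_smul s)).contMDiff.comp
    (contMDiff_coe_sphere (n := 2))

/-- **Bundling into the trivial tangent bundle of the model space**: `C^k` maps
`f, ν : S² → E4` give a `C^k` lift `y ↦ (f y, ν y) ∈ T E4` (the tangent bundle of `E4` is
trivialised by the identity; the pattern of
`Literature.Geometry.Riemannian.EuclideanHypersurface.contMDiff_lift_of_contMDiff`). [folklore] -/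
theorem contMDiff_lift {f ν : sphere (0 : E3) 1 → E4} {k : ℕ∞ω}
    (hf : ContMDiff (𝓡 2) 𝓘(ℝ, E4) k f) (hν : ContMDiff (𝓡 2) 𝓘(ℝ, E4) k ν) :
    ContMDiff (𝓡 2) 𝓘(ℝ, E4).tangent k
      (fun y ↦ (TotalSpace.mk' E4 (f y) (ν y) : TangentBundle 𝓘(ℝ, E4) E4)) := by
  intro y
  rw [ModelWithCorners.tangent, contMDiffAt_totalSpace]
  refine ⟨hf y, ?_⟩
  simpa only [trivializationAt_model_space_apply] using hν y

/-! ### Transfer to the Minkowski development -/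

/-- **The section `y ↦ (r, r y)`, `r ≠ 0`, is a spacelike immersion of `S²` into the Minkowski
development** (`IsSpacelikeImmersion`: `C^∞` with positive definite induced form).
[cite: ONeill1983, Ch. 5, p. 142] -/
theorem isSpacelikeImmersion_sec {r : ℝ} (hr : r ≠ 0) :
    Minkowski.vacuumCauchyDevelopment.toCauchyDevelopment.metric.IsSpacelikeImmersion (𝓡 2)
      (fun y : sphere (0 : E3) 1 ↦ E4.ofTimeSpace r (r • (y : E3))) := by
  refine ⟨?_, fun y v hv ↦ ?_⟩
  · exact contMDiff_sec r
  · rw [PseudoRiemannianMetric.inducedBilin_apply]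
    exact bilin_mfderiv_sec_pos hr y hv

/-- **The null normal pair `L = (1, y)`, `L̲ = (1, -y)` of the section `y ↦ (r, r y)` in the
Minkowski development**: normal, null, future-directed for `∂ₜ`, `η(L, L̲) = -2`, and smooth along
the sphere (all fields of `LorentzianMetric.NullNormalPair` discharged). [cite: HawkingEllis1973, §4.2] -/
theorem exists_nullNormalPair (r : ℝ) :
    ∃ P : LorentzianMetric.NullNormalPair (𝓡 2)
        Minkowski.vacuumCauchyDevelopment.toCauchyDevelopment.metric
        Minkowski.vacuumCauchyDevelopment.toCauchyDevelopment.timeOrientation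
        (fun y : sphere (0 : E3) 1 ↦ E4.ofTimeSpace r (r • (y : E3))),
      (∀ y, P.L y = E4.ofTimeSpace 1 (y : E3)) ∧
      (∀ y, P.Lbar y = E4.ofTimeSpace 1 (-(y : E3))) := by
  have hL : ∀ y : sphere (0 : E3) 1, E4.ofTimeSpace 1 (y : E3) = E4.ofTimeSpace 1 ((1 : ℝ) • (y : E3)) :=
    fun y ↦ by rw [one_smul]
  have hLbar : ∀ y : sphere (0 : E3) 1,
      E4.ofTimeSpace 1 (-(y : E3)) = E4.ofTimeSpace 1 ((-1 : ℝ) • (y : E3)) :=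
    fun y ↦ by rw [neg_one_smul]
  refine ⟨{ L := fun y ↦ E4.ofTimeSpace 1 (y : E3)
            Lbar := fun y ↦ E4.ofTimeSpace 1 (-(y : E3))
            isNormalTo_L := fun y v ↦ ?_
            isNormalTo_Lbar := fun y v ↦ ?_
            isNull_L := fun y ↦ ?_
            isNull_Lbar := fun y ↦ ?_
            isFutureDirected_L := fun y ↦ ?_
            isFutureDirected_Lbar := fun y ↦ ?_
            val_L_Lbar := fun y ↦ ?_
            contMDiff_L := ?_
            contMDiff_Lbar := ?_ }, fun _ ↦ rfl, fun _ ↦ rfl⟩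
  · change bilin (E4.ofTimeSpace 1 (y : E3)) (mfderiv (𝓡 2) 𝓘(ℝ, E4)
      (fun y : sphere (0 : E3) 1 ↦ E4.ofTimeSpace r (r • (y : E3))) y v) = 0
    rw [hL]
    exact bilin_ofTimeSpace_one_mfderiv_sec r y 1 v
  · change bilin (E4.ofTimeSpace 1 (-(y : E3))) (mfderiv (𝓡 2) 𝓘(ℝ, E4)
      (fun y : sphere (0 : E3) 1 ↦ E4.ofTimeSpace r (r • (y : E3))) y v) = 0
    rw [hLbar]
    exact bilin_ofTimeSpace_one_mfderiv_sec r y (-1) v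
  · change bilin (E4.ofTimeSpace 1 (y : E3)) (E4.ofTimeSpace 1 (y : E3)) = 0 ∧
      E4.ofTimeSpace 1 (y : E3) ≠ 0
    refine ⟨?_, ofTimeSpace_one_ne_zero _⟩
    rw [hL, bilin_ofTimeSpace_one_smul]
    norm_num
  · change bilin (E4.ofTimeSpace 1 (-(y : E3))) (E4.ofTimeSpace 1 (-(y : E3))) = 0 ∧
      E4.ofTimeSpace 1 (-(y : E3)) ≠ 0
    refine ⟨?_, ofTimeSpace_one_ne_zero _⟩
    rw [hLbar, bilin_ofTimeSpace_one_smul]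
    norm_num
  · change (bilin (E4.ofTimeSpace 1 (y : E3)) (E4.ofTimeSpace 1 (y : E3)) ≤ 0 ∧
        E4.ofTimeSpace 1 (y : E3) ≠ 0) ∧
      bilin (E4.basisVector 0) (E4.ofTimeSpace 1 (y : E3)) < 0
    refine ⟨⟨?_, ofTimeSpace_one_ne_zero _⟩, ?_⟩
    · rw [hL, bilin_ofTimeSpace_one_smul]
      norm_num
    · rw [bilin_basisVector_zero_ofTimeSpace_one]
      norm_num
  · change (bilin (E4.ofTimeSpace 1 (-(y : E3))) (E4.ofTimeSpace 1 (-(y : E3))) ≤ 0 ∧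
        E4.ofTimeSpace 1 (-(y : E3)) ≠ 0) ∧
      bilin (E4.basisVector 0) (E4.ofTimeSpace 1 (-(y : E3))) < 0
    refine ⟨⟨?_, ofTimeSpace_one_ne_zero _⟩, ?_⟩
    · rw [hLbar, bilin_ofTimeSpace_one_smul]
      norm_num
    · rw [bilin_basisVector_zero_ofTimeSpace_one]
      norm_num
  · change bilin (E4.ofTimeSpace 1 (y : E3)) (E4.ofTimeSpace 1 (-(y : E3))) = -2
    rw [hL, hLbar, bilin_ofTimeSpace_one_smul]
    norm_num
  · change ContMDiff (𝓡 2) 𝓘(ℝ, E4).tangent 1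
      (fun y : sphere (0 : E3) 1 ↦ (TotalSpace.mk' E4 (E4.ofTimeSpace r (r • (y : E3)))
        (E4.ofTimeSpace 1 (y : E3)) : TangentBundle 𝓘(ℝ, E4) E4))
    have h1 : ContMDiff (𝓡 2) 𝓘(ℝ, E4) 1 (fun y : sphere (0 : E3) 1 ↦ E4.ofTimeSpace 1 (y : E3)) := by
      have := contMDiff_ofTimeSpace_one_smul 1 (m := 1)
      simp only [one_smul] at this
      exact this
    exact contMDiff_lift (contMDiff_sec r) h1
  · change ContMDiff (𝓡 2) 𝓘(ℝ, E4).tangent 1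
      (fun y : sphere (0 : E3) 1 ↦ (TotalSpace.mk' E4 (E4.ofTimeSpace r (r • (y : E3)))
        (E4.ofTimeSpace 1 (-(y : E3))) : TangentBundle 𝓘(ℝ, E4) E4))
    have h1 : ContMDiff (𝓡 2) 𝓘(ℝ, E4) 1
        (fun y : sphere (0 : E3) 1 ↦ E4.ofTimeSpace 1 (-(y : E3))) := by
      have := contMDiff_ofTimeSpace_one_smul (-1) (m := 1)
      simp only [neg_one_smul] at this
      exact this
    exact contMDiff_lift (contMDiff_sec r) h1

end MinkowskiSphereSection

/-! ### The registered stub -/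

/-- **S2 — THE SECTIONS ARE SMOOTH SPACELIKE SPHERES WITH NULL NORMAL PAIR `((1, y), (1, -y))`.**
For `r > 0` the map `y ↦ (r, r y)` of the unit sphere into the Minkowski development is a smooth
embedding (`C^∞`, injective, injective differential, compact source:
`Literature.Topology.FourManifolds.isSmoothEmbedding_of_injective_of_injective_mfderiv`), a
spacelike immersion for `η` (`η((0, r v), (0, r v)) = r²‖v‖² > 0`), and carries the null normal
pair `L = (1, y)`, `L̲ = (1, -y)`: normal (`⟪y, v⟫ = 0` on `T_y S²`), null, future-directed,
`η(L, L̲) = -1 - ‖y‖² = -2`, smooth along the sphere.  O'Neill 1983, Ch. 4, p. 97 ff.;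
Hawking–Ellis 1973, §4.2. [cite: HawkingEllis1973, §4.2] -/
theorem stub_minkowskiSphereSection : open scoped Manifold in
    ∀ r : ℝ, 0 < r →
      Manifold.IsSmoothEmbedding (𝓡 2) (𝓡 (3 + 1)) ((⊤ : ℕ∞) : WithTop ℕ∞)
          (fun y : Metric.sphere (0 : Literature.Geometry.Lorentzian.E3) 1 ↦
            Literature.Geometry.Lorentzian.E4.ofTimeSpace r (r • (y : Literature.Geometry.Lorentzian.E3))) ∧
      Literature.Geometry.Lorentzian.Minkowski.vacuumCauchyDevelopment.toCauchyDevelopment.metric.IsSpacelikeImmersion (𝓡 2)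
          (fun y : Metric.sphere (0 : Literature.Geometry.Lorentzian.E3) 1 ↦
            Literature.Geometry.Lorentzian.E4.ofTimeSpace r (r • (y : Literature.Geometry.Lorentzian.E3))) ∧
      ∃ P : Literature.Geometry.Lorentzian.LorentzianMetric.NullNormalPair (𝓡 2)
          Literature.Geometry.Lorentzian.Minkowski.vacuumCauchyDevelopment.toCauchyDevelopment.metric
          Literature.Geometry.Lorentzian.Minkowski.vacuumCauchyDevelopment.toCauchyDevelopment.timeOrientation
          (fun y : Metric.sphere (0 : Literature.Geometry.Lorentzian.E3) 1 ↦
            Literature.Geometry.Lorentzian.E4.ofTimeSpace r (r • (y : Literature.Geometry.Lorentzian.E3))),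
        (∀ y, P.L y = Literature.Geometry.Lorentzian.E4.ofTimeSpace 1 (y : Literature.Geometry.Lorentzian.E3)) ∧
        (∀ y, P.Lbar y = Literature.Geometry.Lorentzian.E4.ofTimeSpace 1 (-(y : Literature.Geometry.Lorentzian.E3))) := by
  intro r hr
  exact ⟨MinkowskiSphereSection.isSmoothEmbedding_sec hr.ne',
    MinkowskiSphereSection.isSpacelikeImmersion_sec hr.ne',
    MinkowskiSphereSection.exists_nullNormalPair r⟩

end Summit.FinalStateConjecture.FinalStateConjecture.Theorems.BondiDrainDispersalHorizonlessMustDrain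

end
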